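import Summits.NavierStokesRegularity.NavierStokesRegularity.Theorems.DssFarFieldSlavingBlowupTypeIDssProfileLargeOrderCompactness
import Summits.NavierStokesRegularity.NavierStokesRegularity.Theorems.DssFarFieldSlavingBlowupTypeIDssProfileClassToProfile
import HarnessLib

/-!
# Large symmetry order: `m`-fold symmetric Type-I ancient solutions with `m ≥ m₀(C₀)` are trivial —
  NO self-similarity needed (route `DssFarFieldSlaving`, crux `BlowupTypeIDssProfile`,
  stmt-NavierStokesRegularity-0155 — SUPPORT; cell pub-ns-dss theory items T21 / T18 / T21c, landed by
  the typer from the theory seat's kernel-checked sketch HOME/theory/LiouvilleSideSketch.lean v1.4 §5d–§5f)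

* `largeOrderTypeILiouville` (T21, classical level): for every `C₀ > 0` there is `m₀` such that every
  classical solution of Navier–Stokes (`ν = 1`, no force) on `(EuclideanSpace ℝ (Fin 3)) × (−∞,0)` with
  `‖u(t,x)‖ ≤ C₀/(‖x‖+√(−t))` and `m`-fold symmetric slices about `e₃`
  (`u(t, R_{2π/m}x) = R_{2π/m}u(t,x)`), `m ≥ m₀`, vanishes identically.  Proof: if not, Chae–Wolf's
  `ε₀` (`ChaeWolf.exists_eps_typeI_small_eq_zero`) and a continuous rescaling give witnesses at
  `t = −1` (`largeOrder_rescaledWitness`); `largeOrderCompactness` gives an axisymmetric Type-I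
  bounded weak limit nonzero at `t = −1`; KNSS 2009 Thm 5.3 (`KNSS2009_liouville_bound_C_over_r_holds`,
  PROVED in tree) kills it (`largeOrder_knss_kill`).  `m₀` is INEFFECTIVE (contradiction argument):
  the theorem says nothing at any fixed small `m`.
* `largeOrderRssLiouville` (T18): the rotated-self-similar corollary in the shape of
  `pineauVicol2026_rss_liouville` — an `α`-RSS classical Type-I(`C₀`) solution on `[−1,0)` whose `C²`
  profile is `m`-fold symmetric, `m ≥ m₀(C₀)`, has zero profile (any `α`).
* `typeI_ancient_mFold_ae_zero` / `rdssClass_mFold_ae_zero` (T21c, CLASS level): the same for the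
  duality-form class (ancient mild, measurable slices, Type-I(`M`), slices a.e. `m`-fold symmetric),
  through the typer's classical representative at the same constant
  (`typeI_ancient_classicalRepresentative`) and a.e. → pointwise equivariance of continuous slices.

Authorship: statements and proofs are the theory seat's (planner-pub-ns-dss-theory-g2, sketch v1.4);
the typer unfolded the sketch's `def`s into explicit statements and discharged the sketch's
`ClassicalRepresentative` hypothesis by the landed `typeI_ancient_classicalRepresentative`.
Nothing numeric; no claim about Navier–Stokes regularity or blow-up.

## References

* D. Chae, J. Wolf, Comm. PDE 42 (2017) = arXiv:1610.09464, Thm 1.3, Remark 1.4, §3. [ChaeWolf2017RemovingDSS]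
* G. Koch, N. Nadirashvili, G. Seregin, V. Šverák, Acta Math. 203 (2009), Thm 5.3. [KochNadirashviliSereginSverak2009]
* B. Pineau, V. Vicol, arXiv:2607.09619 (2026), Thm 1.4 (shape of the RSS corollary). [PineauVicol2026]
-/

set_option linter.dupNamespace false

noncomputable section

namespace Summit.NavierStokesRegularity.NavierStokesRegularity.Theorems.LargeOrderLiouville

open MeasureTheory Set Function Filter Metric
open scoped NNReal
open Literature.Analysis.FluidPDE
open Summit.NavierStokesRegularity.NavierStokesRegularity.Theorems
open Literature.Analysis.FluidPDE.PineauVicol2026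
open scoped Topology Laplacian ContDiff


/-- a.e.-vanishing slices of a jointly continuous field vanish identically on `t < 0` (turns the
KNSS a.e. conclusion into the pointwise contradiction with the compactness witness). -/
theorem eq_zero_of_continuous_of_ae_slices {w : ℝ → (EuclideanSpace ℝ (Fin 3)) → (EuclideanSpace ℝ (Fin 3))} (hc : Continuous (uncurry w))
    (h : ∀ᵐ t ∂(volume.restrict (Iio (0 : ℝ))), w t =ᵐ[volume] 0) :
    ∀ t < 0, ∀ x, w t x = 0 := by
  have hslice : ∀ t, Continuous (w t) := fun t =>
    hc.comp (Continuous.prodMk continuous_const continuous_id)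
  have h2 : ∀ᵐ t ∂(volume.restrict (Iio (0 : ℝ))), w t = 0 :=
    h.mono fun t ht => ((hslice t).ae_eq_iff_eq volume continuous_const).1 ht
  intro t₀ ht₀ x
  have hg : Continuous fun t => w t x :=
    hc.comp (Continuous.prodMk continuous_id continuous_const)
  by_contra hne
  have hUo : IsOpen ({t : ℝ | w t x ≠ 0} ∩ Iio 0) :=
    (isOpen_ne_fun hg continuous_const).inter isOpen_Iio
  have hUpos : 0 < volume ({t : ℝ | w t x ≠ 0} ∩ Iio 0) :=
    hUo.measure_pos volume ⟨t₀, hne, ht₀⟩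
  have hnull : volume.restrict (Iio (0 : ℝ)) {t : ℝ | w t x ≠ 0} = 0 := by
    refine measure_mono_null (fun t (ht : w t x ≠ 0) => ?_) (ae_iff.1 h2)
    exact fun h0 => ht (by rw [h0]; rfl)
  rw [Measure.restrict_apply' measurableSet_Iio] at hnull
  exact absurd hnull hUpos.ne'

/-- **T21 step (1), PROVED.** A nontrivial classical Type-I `C_m`-symmetric solution, continuously
rescaled, has a Chae–Wolf witness on the slice `t = −1`: `‖x‖ ≤ 2C₀/ε₀`, `‖u(−1,x)‖ ≥ ε₀/2`
(`ε₀` any constant with the smallness-implies-zero property of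
`ChaeWolf.exists_eps_typeI_small_eq_zero`). No self-similarity is used. -/
theorem largeOrder_rescaledWitness {ε₀ C₀ : ℝ} (hε₀ : 0 < ε₀) (hC₀ : 0 ≤ C₀)
    (hε : ∀ {C : ℝ} {u : ℝ → (EuclideanSpace ℝ (Fin 3)) → (EuclideanSpace ℝ (Fin 3))} {p : ℝ → (EuclideanSpace ℝ (Fin 3)) → ℝ}, 0 ≤ C →
      IsClassicalNSSolutionOn (Iio 0) 1 0 u p → HasTypeIDecay C u →
      (∀ t < 0, ∀ x, √(-t) * ‖u t x‖ ≤ ε₀) → ∀ t < 0, ∀ x, u t x = 0)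
    {m : ℕ} {u : ℝ → (EuclideanSpace ℝ (Fin 3)) → (EuclideanSpace ℝ (Fin 3))} {p : ℝ → (EuclideanSpace ℝ (Fin 3)) → ℝ}
    (hsol : IsClassicalNSSolutionOn (Iio 0) 1 0 u p) (hI : HasTypeIDecay C₀ u)
    (hsym : (∀ t < 0, ∀ x : (EuclideanSpace ℝ (Fin 3)), u t (rotZ (2 * Real.pi / m) x) = rotZ (2 * Real.pi / m) (u t x))) (hne : ¬ ∀ t < 0, ∀ x, u t x = 0) :
    ∃ (l : ℝ) (q : ℝ → (EuclideanSpace ℝ (Fin 3)) → ℝ), 0 < l ∧ IsClassicalNSSolutionOn (Iio 0) 1 0 (nsRescale l u) q ∧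
      HasTypeIDecay C₀ (nsRescale l u) ∧ (∀ t < 0, ∀ x : (EuclideanSpace ℝ (Fin 3)), (nsRescale l u) t (rotZ (2 * Real.pi / m) x) = rotZ (2 * Real.pi / m) ((nsRescale l u) t x)) ∧
      ∃ x : (EuclideanSpace ℝ (Fin 3)), ‖x‖ ≤ 2 * C₀ / ε₀ ∧ ε₀ / 2 ≤ ‖nsRescale l u (-1) x‖ := by
  -- a point with `√(−t₀) ‖u(t₀,x₀)‖ > ε₀`
  have hpt : ∃ t₀ < (0 : ℝ), ∃ x₀ : (EuclideanSpace ℝ (Fin 3)), ε₀ < √(-t₀) * ‖u t₀ x₀‖ := by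
    by_contra h
    push Not at h
    exact hne (hε hC₀ hsol hI h)
  obtain ⟨t₀, ht₀, x₀, hx₀⟩ := hpt
  set l : ℝ := √(-t₀) with hl
  have hl0 : 0 < l := Real.sqrt_pos.2 (by linarith)
  have hl2 : l ^ 2 = -t₀ := Real.sq_sqrt (by linarith)
  -- the rescaled classical solution on `(−∞, 0)`
  have h1 := IsClassicalNSSolutionOn.nsRescale_holds hsol hl0
  have hS : (fun t : ℝ => l ^ 2 * t) ⁻¹' Iio (0 : ℝ) = Iio 0 := by
    ext s
    simp only [mem_preimage, mem_Iio]
    constructor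
    · intro h
      by_contra hs
      have : 0 ≤ l ^ 2 * s := mul_nonneg (sq_nonneg l) (not_lt.1 hs)
      linarith
    · exact fun h => mul_neg_of_pos_of_neg (by positivity) h
  rw [nsRescaleForce_zero, hS] at h1
  refine ⟨l, nsRescalePressure l p, hl0, h1, hI.nsRescale hl0, mFold_nsRescale hsym hl0, l⁻¹ • x₀, ?_⟩
  -- the witness at `t = −1`
  have hval : nsRescale l u (-1) (l⁻¹ • x₀) = l • u t₀ x₀ := by
    rw [nsRescale_apply, smul_smul, mul_inv_cancel₀ hl0.ne', one_smul, mul_neg_one, hl2, neg_neg]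
  have hq : ε₀ < √(-(-1 : ℝ)) * ‖nsRescale l u (-1) (l⁻¹ • x₀)‖ := by
    rw [neg_neg, Real.sqrt_one, one_mul, hval, norm_smul, Real.norm_of_nonneg hl0.le]
    exact hx₀
  have hmem : (-1 : ℝ) ∈ Icc (-(1 : ℝ) ^ 2) (-1) := by norm_num
  exact ChaeWolf.witness_of_point hε₀ hC₀ zero_le_one (by norm_num) (hI.nsRescale hl0) hmem hq

/-- **T21 steps (3)+(4), PROVED.** The compactness limit is killed by KNSS 2009 Thm 5.3
(`KNSS2009_liouville_bound_C_over_r_holds`): continuous, Type-I on `t ≤ −1/4` (`r‖v‖ ≤ C₀` by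
`cylRadius_mul_norm_le_of_le`), bounded weak solution after the `−1/4` time shift,
axisymmetric slices ⇒ `v(−1, ·) ≡ 0`. -/
theorem largeOrder_knss_kill {C₀ : ℝ} {v : ℝ → (EuclideanSpace ℝ (Fin 3)) → (EuclideanSpace ℝ (Fin 3))} (hcont : Continuous (uncurry v))
    (hI : ∀ t ≤ -(1 / 4 : ℝ), ∀ x, ‖v t x‖ ≤ C₀ / (‖x‖ + Real.sqrt (-t)))
    (hweak : IsBoundedWeakNSSolutionOn (Iio 0) isOpen_Iio 1 (fun t => v (t - 1 / 4)))
    (hax : ∀ t ≤ -(1 / 4 : ℝ), IsAxisymmetric (v t)) : ∀ x, v (-1) x = 0 := by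
  set w : ℝ → (EuclideanSpace ℝ (Fin 3)) → (EuclideanSpace ℝ (Fin 3)) := fun t => v (t - 1 / 4) with hw
  have haxw : ∀ t < 0, IsAxisymmetric (w t) := fun t ht => hax (t - 1 / 4) (by linarith)
  have hbd : ∀ t < 0, ∀ x, cylRadius x * ‖w t x‖ ≤ C₀ := fun t ht x =>
    cylRadius_mul_norm_le_of_le (t := t - 1 / 4) (by linarith) (hI (t - 1 / 4) (by linarith) x)
  have hknss := KNSS2009_liouville_bound_C_over_r_holds hweak (ae_rotZ_of_isAxisymmetric haxw)
    ⟨C₀, ae_cylRadius_mul_norm_le_of_forall hbd⟩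
  have hcw : Continuous (uncurry w) := by
    have : uncurry w = uncurry v ∘ fun q : ℝ × (EuclideanSpace ℝ (Fin 3)) => (q.1 - 1 / 4, q.2) := by
      funext q; rfl
    rw [this]
    exact hcont.comp ((continuous_fst.sub continuous_const).prodMk continuous_snd)
  intro x
  have h := eq_zero_of_continuous_of_ae_slices hcw hknss (-3 / 4) (by norm_num) x
  simp only [hw] at h
  norm_num at h
  exact h

/-- **T21 `largeOrderTypeILiouville` (classical level; theory seat, sketch v1.4):** for every
`C₀ > 0` there is `m₀` such that every classical solution of Navier–Stokes (`ν = 1`, no force) on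
`(EuclideanSpace ℝ (Fin 3)) × (−∞,0)` with `‖u(t,x)‖ ≤ C₀/(‖x‖+√(−t))` and `m`-fold symmetric slices about `e₃`, `m ≥ m₀`,
vanishes identically.  NO self-similarity hypothesis; `m₀` ineffective.
[cite: KochNadirashviliSereginSverak2009, Thm 5.3] -/
theorem largeOrderTypeILiouville :
    ∀ C₀ : ℝ, 0 < C₀ → ∃ m₀ : ℕ, ∀ m : ℕ, m₀ ≤ m →
      ∀ (u : ℝ → (EuclideanSpace ℝ (Fin 3)) → (EuclideanSpace ℝ (Fin 3))) (p : ℝ → (EuclideanSpace ℝ (Fin 3)) → ℝ), IsClassicalNSSolutionOn (Iio 0) 1 0 u p →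
        HasTypeIDecay C₀ u → (∀ t < 0, ∀ x : (EuclideanSpace ℝ (Fin 3)), u t (rotZ (2 * Real.pi / m) x) = rotZ (2 * Real.pi / m) (u t x)) → ∀ t < 0, ∀ x, u t x = 0 := by
  intro C₀ hC₀
  obtain ⟨ε₀, hε₀, hε⟩ :=
    ChaeWolf.exists_eps_typeI_small_eq_zero
  by_contra H
  push Not at H
  -- a sequence of counterexamples with symmetry orders `m j ≥ j`
  choose m hm u p hsol hI hsym t ht x hx using H
  have hne : ∀ j, ¬ ∀ s < 0, ∀ y, u j s y = 0 := fun j h => hx j (h (t j) (ht j) (x j))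
  have hwit : ∀ j, ∃ (l : ℝ) (q : ℝ → (EuclideanSpace ℝ (Fin 3)) → ℝ), 0 < l ∧
      IsClassicalNSSolutionOn (Iio 0) 1 0 (nsRescale l (u j)) q ∧
      HasTypeIDecay C₀ (nsRescale l (u j)) ∧ (∀ t < 0, ∀ x : (EuclideanSpace ℝ (Fin 3)), (nsRescale l (u j)) t (rotZ (2 * Real.pi / (m j)) x) = rotZ (2 * Real.pi / (m j)) ((nsRescale l (u j)) t x)) ∧
      ∃ y : (EuclideanSpace ℝ (Fin 3)), ‖y‖ ≤ 2 * C₀ / ε₀ ∧ ε₀ / 2 ≤ ‖nsRescale l (u j) (-1) y‖ := fun j =>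
    largeOrder_rescaledWitness hε₀ hC₀.le hε (hsol j) (hI j) (hsym j) (hne j)
  choose l q hl hsol' hI' hsym' hw using hwit
  have htend : Tendsto m atTop atTop := tendsto_atTop_mono hm tendsto_id
  obtain ⟨v, hcont, hIv, hweak, hax, y, hy⟩ :=
    largeOrderCompactness C₀ ε₀ hC₀ hε₀ m (fun j => nsRescale (l j) (u j)) q htend hsol' hI' hsym' hw
  exact hy (largeOrder_knss_kill hcont hIv hweak hax y)

/-- Rotations about the axis commute with scalar multiplication (via the bundled `rotZL`). -/
private theorem rotZ_smul' (θ c : ℝ) (y : (EuclideanSpace ℝ (Fin 3))) : rotZ θ (c • y) = c • rotZ θ y := by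
  rw [← rotZL_apply, map_smul, rotZL_apply]

/-- Rotations about the same axis commute. -/
private theorem rotZ_comm' (θ φ : ℝ) (y : (EuclideanSpace ℝ (Fin 3))) : rotZ θ (rotZ φ y) = rotZ φ (rotZ θ y) := by
  rw [← rotZ_add, add_comm, rotZ_add]

/-- The Pineau–Vicol RSS ansatz with an `m`-fold symmetric stationary profile is `m`-fold symmetric
(the twist rotations and the symmetry rotation share the axis, hence commute). -/
theorem mFold_pvAnsatz {m : ℕ} {α : ℝ} {U : (EuclideanSpace ℝ (Fin 3)) → (EuclideanSpace ℝ (Fin 3))}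
    (hU : ∀ y, U (rotZ (2 * Real.pi / m) y) = rotZ (2 * Real.pi / m) (U y)) :
    (∀ t < 0, ∀ x : (EuclideanSpace ℝ (Fin 3)), (pvAnsatz α (fun y _ => U y)) t (rotZ (2 * Real.pi / m) x) = rotZ (2 * Real.pi / m) ((pvAnsatz α (fun y _ => U y)) t x)) := by
  intro t _ x
  simp only [pvAnsatz]
  rw [← rotZ_smul' (2 * Real.pi / m), rotZ_comm' (-(α * -Real.log (-t))) (2 * Real.pi / m), hU,
    rotZ_comm' (α * -Real.log (-t)) (2 * Real.pi / m), ← rotZ_smul' (2 * Real.pi / m)]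

/-- **T18 `LargeOrderRssLiouville` is a THEOREM (v1.4)** — corollary of T21: a `C_m`-symmetric RSS
profile (ANY twist `α`) at Type-I bound `C₀` vanishes once `m ≥ m₀(C₀)`. -/
theorem largeOrderRssLiouville :
    ∀ C₀ : ℝ, 0 < C₀ → ∃ m₀ : ℕ, ∀ m : ℕ, m₀ ≤ m →
      ∀ (α : ℝ) (u : ℝ → (EuclideanSpace ℝ (Fin 3)) → (EuclideanSpace ℝ (Fin 3))) (p : ℝ → (EuclideanSpace ℝ (Fin 3)) → ℝ) (U : (EuclideanSpace ℝ (Fin 3)) → (EuclideanSpace ℝ (Fin 3))),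
        IsClassicalNSSolutionOn (Ico (-1) 0) 1 0 u p →
        (∀ t ∈ Ico (-1 : ℝ) 0, ∀ x : (EuclideanSpace ℝ (Fin 3)), ‖u t x‖ ≤ C₀ / (‖x‖ + Real.sqrt (-t))) →
        ContDiff ℝ 2 U → (∀ y, U (rotZ (2 * Real.pi / m) y) = rotZ (2 * Real.pi / m) (U y)) →
        (∀ t ∈ Ico (-1 : ℝ) 0, ∀ x : (EuclideanSpace ℝ (Fin 3)), u t x = pvAnsatz α (fun y _ => U y) t x) → U = 0 := by
  intro C₀ hC₀
  obtain ⟨m₀, hm₀⟩ := largeOrderTypeILiouville C₀ hC₀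
  refine ⟨m₀, fun m hm α u p U hsol hI _hU hsymU hans => ?_⟩
  obtain ⟨P, hP⟩ := exists_isClassicalNSSolutionOn_Iio_of_isRotatedDSS hsol one_lt_two
    (isRotatedDSS_pvAnsatz (α := α) (U := fun y _ => U y) two_pos fun _ _ => rfl) hans
  have hIw : HasTypeIDecay C₀ (pvAnsatz α (fun y _ => U y)) := fun t ht x =>
    norm_pvAnsatz_le_of_profile (profile_bound_of_typeI hI hans) ht x
  have h0 := hm₀ m hm _ P hP hIw (mFold_pvAnsatz hsymU)
  funext y
  simpa [pvAnsatz_neg_one] using h0 (-1) (by norm_num) y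

/-! ### Class level (T21c): through the classical representative at the same constant -/

/-- **T21c, CLASS level (no self-similarity): `m`-fold a.e.-symmetric Type-I ancient MILD solutions
with `m ≥ m₀(M)` are a.e. trivial.**  For every `M > 0` there is `m₀` such that every ancient mild
solution (`ν = 1`, duality form) with measurable slices, `‖u(t,x)‖ ≤ M/(‖x‖+√(−t))`, and slices
a.e. equivariant under `R_{2π/m}` for some `m ≥ m₀` is a.e. zero on every slice `t < 0`: its
classical representative at the same constant (`typeI_ancient_classicalRepresentative`) has
POINTWISE `m`-fold symmetric slices (`equivariant_of_ae_equivariant`) and `largeOrderTypeILiouville`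
applies. [cite: KochNadirashviliSereginSverak2009, Thm 5.3] -/
theorem typeI_ancient_mFold_ae_zero :
    ∀ M : ℝ, 0 < M → ∃ m₀ : ℕ, ∀ m : ℕ, m₀ ≤ m → ∀ (u : ℝ → (EuclideanSpace ℝ (Fin 3)) → (EuclideanSpace ℝ (Fin 3))),
      IsAncientMildSolution 1 u → (∀ t < 0, AEStronglyMeasurable (u t) volume) → HasTypeIDecay M u →
      (∀ t < 0, (fun x => u t (rotZ (2 * Real.pi / m) x)) =ᵐ[volume] fun x => rotZ (2 * Real.pi / m) (u t x)) →
      ∀ t < 0, u t =ᵐ[volume] 0 := by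
  intro M hM
  obtain ⟨m₀, hm₀⟩ := largeOrderTypeILiouville M hM
  refine ⟨m₀, fun m hm u hu hmeas hdec hG t ht => ?_⟩
  obtain ⟨V, P, -, hV, hVdec, hVu, -⟩ := typeI_ancient_classicalRepresentative hu hmeas hdec
  have hVc : ∀ s < 0, Continuous (V s) := fun s hs =>
    continuous_slice_of_isClassicalNSSolutionOn_Iio hV hs
  have hsym : ∀ s < 0, ∀ x : (EuclideanSpace ℝ (Fin 3)), V s (rotZ (2 * Real.pi / m) x) = rotZ (2 * Real.pi / m) (V s x) := by
    intro s hs x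
    have hg := hG s hs
    have key := equivariant_of_ae_equivariant (rotZLIE (2 * Real.pi / m)) (hVc s hs) (hVu s hs)
      (by simpa only [rotZLIE_apply] using hg) x
    simpa only [rotZLIE_apply] using key
  have h0 := hm₀ m hm V P hV hVdec hsym
  have hV0 : V t = 0 := funext fun x => h0 t ht x
  have key := hVu t ht
  rw [hV0] at key
  exact key.symm

/-- **T21c for the rotated-DSS class of the crux** (`LargeOrderControl` of the cell): for every
`M > 0` there is `m₀` such that, for EVERY factor `c` and EVERY isometry `R`, every member of the
Type-I(`M`) rotated-DSS class with slices a.e. equivariant under `R_{2π/m}`, `m ≥ m₀`, is a.e.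
trivial — the self-similarity is not used. [cite: KochNadirashviliSereginSverak2009, Thm 5.3] -/
theorem rdssClass_mFold_ae_zero :
    ∀ M : ℝ, 0 < M → ∃ m₀ : ℕ, ∀ m : ℕ, m₀ ≤ m →
      ∀ (c : ℝ) (R : (EuclideanSpace ℝ (Fin 3)) ≃ₗᵢ[ℝ] (EuclideanSpace ℝ (Fin 3))) (u : ℝ → (EuclideanSpace ℝ (Fin 3)) → (EuclideanSpace ℝ (Fin 3))),
        1 < c → IsAncientMildSolution 1 u → (∀ t < 0, AEStronglyMeasurable (u t) volume) →
        IsRotatedDSS c R u → HasTypeIDecay M u →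
        (∀ t < 0, (fun x => u t (rotZ (2 * Real.pi / m) x)) =ᵐ[volume] fun x => rotZ (2 * Real.pi / m) (u t x)) →
        ∀ t < 0, u t =ᵐ[volume] 0 := by
  intro M hM
  obtain ⟨m₀, hm₀⟩ := typeI_ancient_mFold_ae_zero M hM
  exact ⟨m₀, fun m hm c R u _ hu hmeas _ hdec hG => hm₀ m hm u hu hmeas hdec hG⟩

end Summit.NavierStokesRegularity.NavierStokesRegularity.Theorems.LargeOrderLiouville

end
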